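/-
Copyright (c) 2026 the pub-hodgecm-mathlib formalisation cell (harness21).  Prover seat hodgecm-mathlib-LH4-p15 (g3), req620 Track A «(D-RAM) FOUR-FRAME» squad
((β₂) road (R-36), the K6 road — K6 DESK WORD #22 A5 «THE TOP CELL IDENTITY»: the ON-SHELL dictionary of ★ p864616∕p864854 (LH4-p12 (g9)) with its unit letter as an
EQUIVALENCE, so the top cell's `NX`-sphere (F1b-top ★ p864859) is EXACTLY the unit-label sphere of ★ (g-top) p864688), 2026-09-05.
-/
import Summits.HodgeConjecture.HodgeConjecture.Theorems.F0P3cDyRamAffineLabelOnShell        -- ★ p864616∕p864854 (LH4-p12 (g9)): the on-shell dictionary (`→` unit letter); brings ★ p862927's toolkit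
import HarnessLib

/-!
# Crux `H413`, line LH4 «(D-RAM) FOUR-FRAME» — (β₂) road, the K6 road, A5 support: «THE AFFINE LABEL ON THE SHELL — THE UNIT LETTER IS AN EQUIVALENCE» —
# for the dictionary pair `(α₁, γ₁)` of ★ p864854 `exists_affineLabel_of_coords_onShell_unit`: `|â + b̂V| = |â| ↔ |α₁ + γ₁V| = 1` for every `σ`-fixed integral digit `V`

Cell `hodgecm-mathlib` (D-0151), FLOOR 0, crux item H413 = `stmt-HodgeConjecture-24833`, route of record `HCCMUnconditional`; squad F0∕P3c∕LH4; lane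
`--supports stmt-HodgeConjecture-24833 --as helper` (count-neutral; pays NO tier-0 row).  THEOREMS ONLY (no `def`, no instance, no notation, no `sorry`, default heartbeats);
★-only imports; states NO law.  `E`-side only: a complete sheet datum `IsRamifiedQuadraticDatum σ ϖ d t` with finite residue field, `d` of ANY parity.

WHY (K6 DESK WORD #22 A5; WORD #13 (c) «NX = the on-shell unit predicate»).  On the TOP cell of a row tower the per-cell law (★ F1b-top p864859) sums the label
`ω(α₁ + γ₁V)` over the digits ON THE SHELL `NX V :⟺ |â + b̂V| = |â|` (chart letters `â = (μ_a + μ_bR₀)P⁻¹`, `b̂ = μ_bγ₀P⁻¹`, `|â| = |b̂|`), while the ONE arithmetic input of the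
spine's top summand, ★ (g-top) p864688 `sum_normSign_affine_topSphere_eq_zero`, sums it over the digits with UNIT LABEL `|α₁ + γ₁V| = 1`.  ★ p864854 exports only `NX V → |α₁ + γ₁V| = 1`
(F1b-top's `hαγ`); the existential packaging of `(α₁, γ₁)` hides the Eisenstein coordinates, so the converse is NOT recoverable from its statement.  THIS FILE re-runs ★ p864854's
construction (`(â + b̂V)∕t₊ = (α₁ + γ₁V) + (y₁ + y₂V)·ϖ`, ★ Lit `exists_fixed_coords_of_map_ne`) and exports the unit letter as an EQUIVALENCE: `|(â + b̂V)∕t₊| = max |α₁ + γ₁V|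
(|y₁ + y₂V|·|ϖ|)` (★ Lit `v_fixed_add_fixed_mul_eq_max`, the `ϖ`-tail has odd `log`), and `|(â + b̂V)∕t₊| ≤ 1` always (`|b̂V| ≤ |â| = |t₊|`), so `|α₁ + γ₁V| = 1` forces the shell.
* HEAD `exists_affineLabel_of_coords_onShell_iff` — ★ p864854's statement VERBATIM with the unit conjunct `… → Valued.v (â + bh * V) = Valued.v â → Valued.v (α₁ + γ₁ * V) = 1`
  REPLACED by `… → (Valued.v (â + bh * V) = Valued.v â ↔ Valued.v (α₁ + γ₁ * V) = 1)`; the dictionary clause unchanged.  (★ p864854 is the `→` corollary; not restated.)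
CONSUMER: «A1-top» `…RowTopChartLetters.exists_rowTopChart_letters` (the TOP chart's letters, both unit letters) ⟶ A5 `…TopCellIdentity` (the class-split `NX`-sphere = (g-top)'s sphere).
WHAT IS NOT CLAIMED: anything about counts, cells or the census; the coordinates `(α₁, γ₁)` are SOME fixed pair (the same construction as ★ p864854's, not provably equal to it).
HONEST LABEL.  Count-neutral `E`-algebra; nothing printed is asserted; no census law is stated; ‹CORE›∕‹CORE-ODD›∕β₂ `stub_law_cleanSgn₂` UNPROVED; `HC_CM` is proved only modulo the
7 printed citations (2 remaining named inputs: hLiu418 = `stmt-HodgeConjecture-24832`, h413 = `stmt-HodgeConjecture-24833`) until rung 0 closes.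
## References
* [Serre1979] J.-P. Serre, *Local Fields*, GTM 67 (1979): Ch. I §6 Prop. 18 (Eisenstein bases), Ch. V §3 Cor. 3 pp. 85–87, Ch. XIV §2–§3 (the norm residue symbol on `U^{(n)}`).
* [Rogawski1990] J. D. Rogawski, Ann. of Math. Stud. 123 (1990): §4.9 Prop. 4.9.1 (b) p. 55; [LanglandsShelstad1987] R. P. Langlands, D. Shelstad, Math. Ann. 278 (1987): §1–§3.
-/

set_option autoImplicit false

noncomputable section

namespace Summit.HodgeConjecture.HodgeConjecture.Cruxes.H413.F0P3cDyRamAffineLabelOnShellIff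

open scoped Valued WithZero
open WithZero
open Literature.NumberTheory.Automorphic.UnitaryThreeFourFrame (IsRamifiedQuadraticDatum normSign)
open Literature.NumberTheory.LocalFields (exists_fixed_coords_of_map_ne v_fixed_add_fixed_mul_eq_max)
open Literature.NumberTheory.LocalFields.WildQuadraticDatum (v_varpi_pow even_log_v_of_fixed map_varpi_ne normSign_eq_of_near normSign_mul_of_fixed)
open Summit.HodgeConjecture.HodgeConjecture.Cruxes.H413.F0P3cDyRamFourFramePieces (mstarOfRecord)
open Summit.HodgeConjecture.HodgeConjecture.Cruxes.H413.F0P3cDyRamLabelShellFlipCardTwo (v_refSkew_eq)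
open Summit.HodgeConjecture.HodgeConjecture.Cruxes.H413.F0P3cDyRamDiagonalCellAffineLabel (v_fst_eq_of_fixed_coords)

variable {K : Type} [Field K] [Valued K ℤᵐ⁰] {σ : K →+* K} {ϖ : K} {d t : ℕ}

/-- **HEAD — «THE AFFINE LABEL ON THE SHELL, UNIT LETTER AS AN EQUIVALENCE».**  ★ p864854 `exists_affineLabel_of_coords_onShell_unit` with its unit conjunct strengthened to
`∀ V, σV = V → |V| ≤ 1 → (|â + b̂V| = |â| ↔ |α₁ + γ₁V| = 1)`: at a complete sheet datum (any parity of `d`), for `|â| = |ϖ|^{d%2}`, `|b̂| = |ϖ|^{2g + d%2}` (`g = 0` allowed) there are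
`σ`-fixed `α₁, γ₁`, `|α₁| = 1`, `|γ₁| = |ϖ|^{2g}`, such that a `σ`-fixed integral digit `V` is ON THE SHELL iff its affine label is a UNIT, and ON the shell the dictionary
`ω(f) = ω(T̂)·ω(α₁ + γ₁V)` holds (★ p864616's clause, byte-identical). [cite: Serre1979, Ch. I §6 Prop. 18] [cite: Serre1979, Ch. V §3 Cor. 3 pp. 85–87] [cite: Serre1979, Ch. XIV §2–§3]
[cite: Rogawski1990, §4.9 Prop. 4.9.1 (b) p. 55] -/
theorem exists_affineLabel_of_coords_onShell_iff [CompleteSpace K] [Finite 𝓀[K]] (hD : IsRamifiedQuadraticDatum σ ϖ d t)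
    {â bh : K} (hâ : Valued.v â = Valued.v ϖ ^ (d % 2)) {g : ℕ} (hbh : Valued.v bh = Valued.v ϖ ^ (2 * g + d % 2)) :
    ∃ α₁ γ₁ : K, σ α₁ = α₁ ∧ Valued.v α₁ = 1 ∧ σ γ₁ = γ₁ ∧ Valued.v γ₁ = Valued.v ϖ ^ (2 * g) ∧
      (∀ V : K, σ V = V → Valued.v V ≤ 1 → (Valued.v (â + bh * V) = Valued.v â ↔ Valued.v (α₁ + γ₁ * V) = 1)) ∧
      ∀ (T V f : K), σ T = T → Valued.v T = 1 → σ V = V → Valued.v V ≤ 1 → σ f = f → Valued.v (â + bh * V) = Valued.v â →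
        Valued.v (T * (â + bh * V) - f * ((ϖ - σ ϖ) * ((ϖ * σ ϖ) ^ ((d - d % 2) / 2))⁻¹)) ≤ Valued.v ϖ ^ mstarOfRecord d →
        normSign σ f = normSign σ T * normSign σ (α₁ + γ₁ * V) := by
  -- adapted from ★ p864854 `…AffineLabelOnShell.exists_affineLabel_of_coords_onShell_unit` (LH4-p12 (g9)); only the converse of the unit letter is new
  obtain ⟨hσσ, hvσ, hϖ, hfix, hdd, hd1, ht⟩ := id hD
  have hvt : Valued.v ((ϖ - σ ϖ) * ((ϖ * σ ϖ) ^ ((d - d % 2) / 2))⁻¹) = Valued.v ϖ ^ (d % 2) := v_refSkew_eq hvσ hϖ hdd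
  have hfix' : ∀ c : K, σ c = c → c ≠ 0 → Even (log (Valued.v c)) := fun c hc hc0 => even_log_v_of_fixed hfix c hc hc0
  have hvϖ0 : Valued.v ϖ ≠ 0 := by rw [hϖ]; exact exp_ne_zero
  have hϖle : Valued.v ϖ ≤ 1 := by rw [hϖ, ← exp_zero]; exact exp_le_exp.2 (by norm_num)
  have hϖσ : σ ϖ ≠ ϖ := map_varpi_ne hϖ hdd
  set tp : K := (ϖ - σ ϖ) * ((ϖ * σ ϖ) ^ ((d - d % 2) / 2))⁻¹ with htp
  have hvt0 : Valued.v tp ≠ 0 := by rw [hvt]; exact pow_ne_zero _ hvϖ0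
  have htp0 : tp ≠ 0 := (Valuation.ne_zero_iff _).1 hvt0
  have hâ0 : Valued.v â ≠ 0 := by rw [hâ]; exact pow_ne_zero _ hvϖ0
  obtain ⟨α₁, y₁, hα₁, hy₁, hα⟩ := exists_fixed_coords_of_map_ne hσσ hϖσ (â / tp)
  obtain ⟨γ₁, y₂, hγ₁, hy₂, hγ⟩ := exists_fixed_coords_of_map_ne hσσ hϖσ (bh / tp)
  have hα1 : Valued.v α₁ = 1 := by
    have h := v_fst_eq_of_fixed_coords hD hα₁ hy₁ (n := 0) (by rw [← hα, map_div₀, hâ, hvt, div_self (pow_ne_zero _ hvϖ0)]; norm_num)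
    rw [h]; norm_num
  have hγ1 : Valued.v γ₁ = Valued.v ϖ ^ (2 * g) := by
    have h := v_fst_eq_of_fixed_coords hD hγ₁ hy₂ (n := -(g : ℤ))
      (by rw [← hγ, map_div₀, hbh, hvt, pow_add, mul_div_cancel_right₀ _ (pow_ne_zero _ hvϖ0), v_varpi_pow hϖ]; push_cast; ring_nf)
    rw [h, v_varpi_pow hϖ]; push_cast; ring_nf
  -- the decomposition `(â + b̂V)∕t₊ = (α₁ + γ₁V) + (y₁ + y₂V)·ϖ`
  have hdec0 : ∀ V : K, (â + bh * V) / tp = (α₁ + γ₁ * V) + (y₁ + y₂ * V) * ϖ := by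
    intro V
    have e1 : â = (α₁ + y₁ * ϖ) * tp := by rw [← hα, div_mul_cancel₀ â htp0]
    have e2 : bh = (γ₁ + y₂ * ϖ) * tp := by rw [← hγ, div_mul_cancel₀ bh htp0]
    rw [e1, e2]; field_simp; ring
  -- THE UNIT LETTER AS AN EQUIVALENCE
  have hiff : ∀ V : K, σ V = V → Valued.v V ≤ 1 → (Valued.v (â + bh * V) = Valued.v â ↔ Valued.v (α₁ + γ₁ * V) = 1) := by
    intro V hσV hV1
    have hσg : σ (α₁ + γ₁ * V) = α₁ + γ₁ * V := by rw [map_add, map_mul, hα₁, hγ₁, hσV]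
    have hσY : σ (y₁ + y₂ * V) = y₁ + y₂ * V := by rw [map_add, map_mul, hy₁, hy₂, hσV]
    have hYϖ1 : Valued.v (y₁ + y₂ * V) * exp (-1 : ℤ) ≠ 1 := by
      intro h1
      by_cases hY0 : y₁ + y₂ * V = 0
      · rw [hY0, map_zero, zero_mul] at h1; exact zero_ne_one h1
      · obtain ⟨n, hn⟩ := hfix _ hσY hY0
        rw [hn, ← exp_add, ← exp_zero, exp_inj] at h1
        omega
    -- `|(â + b̂V)∕t₊| = max |α₁ + γ₁V| (|y₁ + y₂V|·|ϖ|)` and `|(â + b̂V)∕t₊| = |â + b̂V|∕|â|`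
    have hquot : Valued.v ((â + bh * V) / tp) = max (Valued.v (α₁ + γ₁ * V)) (Valued.v (y₁ + y₂ * V) * exp (-1 : ℤ)) := by
      rw [hdec0, v_fixed_add_fixed_mul_eq_max hfix' hϖ hσg hσY]
    have hquot' : Valued.v ((â + bh * V) / tp) = Valued.v (â + bh * V) / Valued.v â := by rw [map_div₀, hvt, hâ]
    constructor
    · intro hshell
      have h1 : max (Valued.v (α₁ + γ₁ * V)) (Valued.v (y₁ + y₂ * V) * exp (-1 : ℤ)) = 1 := by rw [← hquot, hquot', hshell, div_self hâ0]
      rcases max_choice (Valued.v (α₁ + γ₁ * V)) (Valued.v (y₁ + y₂ * V) * exp (-1 : ℤ)) with h | h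
      · rw [h] at h1; exact h1
      · rw [h] at h1; exact absurd h1 hYϖ1
    · intro hunit
      -- `|â + b̂V| ≤ |â|` always (`|b̂V| ≤ |â|`), so the quotient is `≤ 1`; it is `≥ |α₁ + γ₁V| = 1`
      have hle : Valued.v (â + bh * V) ≤ Valued.v â := by
        refine (Valuation.map_add _ _ _).trans (max_le le_rfl ?_)
        rw [Valuation.map_mul, hbh, hâ, pow_add, mul_comm (Valued.v ϖ ^ (2 * g)), mul_assoc]
        exact mul_le_of_le_one_right' ((mul_le_mul' (pow_le_one₀ zero_le hϖle) hV1).trans (by rw [one_mul]))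
      have hq1 : Valued.v ((â + bh * V) / tp) ≤ 1 := by rw [hquot']; exact div_le_one_of_le₀ hle zero_le
      have hq2 : 1 ≤ Valued.v ((â + bh * V) / tp) := by rw [hquot, ← hunit]; exact le_max_left _ _
      have hq : Valued.v (â + bh * V) / Valued.v â = 1 := by rw [← hquot']; exact le_antisymm hq1 hq2
      rwa [div_eq_one_iff_eq hâ0] at hq
  refine ⟨α₁, γ₁, hα₁, hα1, hγ₁, hγ1, hiff, fun T V f hσT hT1 hσV hV1 hσf hshell hsf => ?_⟩
  -- the dictionary clause, as in ★ p864854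
  have hT0 : T ≠ 0 := fun h0 => by rw [h0, map_zero] at hT1; exact zero_ne_one hT1
  set f₀ : K := T * (α₁ + γ₁ * V) with hf₀
  set Y : K := T * (y₁ + y₂ * V) with hY
  have hσf₀ : σ f₀ = f₀ := by rw [hf₀, map_mul, map_add, map_mul, hσT, hα₁, hγ₁, hσV]
  have hσY : σ Y = Y := by rw [hY, map_mul, map_add, map_mul, hσT, hy₁, hy₂, hσV]
  have hdec : T * (â + bh * V) / tp = f₀ + Y * ϖ := by rw [mul_div_assoc, hdec0, hf₀, hY]; ring
  have hf₀1 : Valued.v f₀ = 1 := by rw [hf₀, Valuation.map_mul, hT1, (hiff V hσV hV1).1 hshell, one_mul]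
  have hnear : Valued.v (f₀ - f) ≤ Valued.v ϖ ^ (2 * d - 1) := by
    have h1 : Valued.v (T * (â + bh * V) / tp - f) ≤ Valued.v ϖ ^ (2 * d - 1) := by
      have e : T * (â + bh * V) / tp - f = (T * (â + bh * V) - f * tp) / tp := by field_simp
      rw [e, map_div₀, hvt, div_le_iff₀ (zero_lt_iff.2 (pow_ne_zero _ hvϖ0)), ← pow_add]
      refine hsf.trans (le_of_eq ?_)
      simp only [mstarOfRecord]; congr 1; omega
    rw [hdec] at h1
    have e2 : f₀ + Y * ϖ - f = (f₀ - f) + Y * ϖ := by ring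
    rw [e2, v_fixed_add_fixed_mul_eq_max hfix' hϖ (by rw [map_sub, hσf₀, hσf]) hσY] at h1
    exact (le_max_left _ _).trans h1
  rw [normSign_eq_of_near hD hσf₀ hσf hf₀1 (n := 2 * d - 1) le_rfl hnear, hf₀]
  have hαV0 : α₁ + γ₁ * V ≠ 0 := fun h0 => by
    rw [hf₀, h0, mul_zero, map_zero] at hf₀1; exact zero_ne_one hf₀1
  exact normSign_mul_of_fixed hD hσT (by rw [map_add, map_mul, hα₁, hγ₁, hσV]) hT0 hαV0

end Summit.HodgeConjecture.HodgeConjecture.Cruxes.H413.F0P3cDyRamAffineLabelOnShellIff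

end
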